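import Summits.ValiantsHypothesis.ValiantsHypothesis.Theorems.GrenetZeonPolySizeQPAlgebraNilradicalDepthBox
import Summits.ValiantsHypothesis.ValiantsHypothesis.Theorems.GrenetZeonAbelianizationQPShallow
import HarnessLib

/-!
# A shallow abelianization is a sum of determinants — without locality (stmt-ValiantsHypothesis-8063)

Helper file for the piece `AbelianizationQP` (stmt-8063, line `zeon-window`; open stub
`stub_subexpAbelianization` ≡ the crux).  `sum_dets_of_shallow_algRepr` (file
`GrenetZeonAbelianizationQPShallow.lean`) reads the crux through the depth axis for a LOCAL witness
algebra (a character `φ` with `(ker φ)^ν = 0`).  With the semisimplification over arbitrary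
coefficient algebras (`eq_sum_dets_of_nilradical_pow`, file
`GrenetZeonPolySizeQPAlgebraNilradicalDepth.lean`) the locality hypothesis disappears: whatever
commutative algebra `R` the crux's abelianization uses, if its NILRADICAL has polylogarithmic
nilpotency index `(nilradical R)^((log₂ m + c)^c) = 0`, then the abelianization is nothing but a
`2^(polylog m)`-long linear combination of affine determinants of size `n^c + c` over `ℂ`.

## Main results

* `sum_dets_of_nilShallow_algRepr` — the statement above for one representation.
* `sumDets_of_nilShallow_abelianization` — uniform form: an `AbelianizationQP` whose witness
  algebras have polylogarithmic nilpotency index yields, for every determinantal expression of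
  `per_n` of size `m`, an expression `per_n = Σ_{q<G} α_q det B_q` with `G ≤ 2^((log₂ m + c')^c')`
  and affine `B_q` of size `n^c' + c'` over `ℂ` (`c' = 2c + 4`).  Census reading: the witness
  algebra of the crux must have a DEEP nilradical (as the zeon algebra, index `n + 1`), i.e. at
  least one deep local factor — the number of local factors and the dimension are not where the
  content is — unless subexponential determinantal expressions of the permanent ΣDet-reduce.

No stub is closed; `VP ≠ VNP` is not touched.

## References

* P. Hrubeš, A. Yehudayoff, *Arithmetic complexity in ring extensions*, Theory of Computing 7
  (2011), §2. [cite: HrubesYehudayoff2011, §2]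
-/

set_option linter.dupNamespace false

noncomputable section

namespace Summit.ValiantsHypothesis.ValiantsHypothesis.Theorems.GrenetZeonAbelianizationQP

open MvPolynomial Matrix
open Literature.Computability.AlgebraicComplexity
open Summit.ValiantsHypothesis.ValiantsHypothesis.Theses.GrenetZeon
open Summit.ValiantsHypothesis.ValiantsHypothesis.Theorems.GrenetZeonPolySizeQPAlgebra

/-- **A quasi-polynomial abelianization over ANY coefficient algebra of polylogarithmic nilpotency
index is a quasi-polynomial sum of polynomial-size determinants.**  Let `n ≤ m` and suppose
`per_n = λ(det A)` coefficientwise for an affine matrix `A` of size `n^c + c` over a commutative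
coefficient algebra `R` with `dim R ≤ s ≤ 2^((log₂ m + c)^c)` and
`(nilradical R)^((log₂ m + c)^c) = 0`.  Then `per_n = Σ_{q<G} α_q det B_q` with affine `B_q` of the
same size over `ℂ` and `G ≤ 2^((log₂ m + 2c + 4)^(2c + 4))` (`eq_sum_dets_of_nilradical_pow`,
`mul_pow_pred_le_pow`, `depth_budget`). [cite: HrubesYehudayoff2011, §2] -/
theorem sum_dets_of_nilShallow_algRepr {n m c s : ℕ} (hnm : n ≤ m)
    (hs : s ≤ 2 ^ ((Nat.log 2 m + c) ^ c))
    {R : Type} [CommRing R] [Algebra ℂ R] [Module.Finite ℂ R]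
    (hν : (nilradical R) ^ ((Nat.log 2 m + c) ^ c) = ⊥) (hR : Module.finrank ℂ R ≤ s)
    (l : R →ₗ[ℂ] ℂ) (A : Matrix (Fin (n ^ c + c)) (Fin (n ^ c + c)) (MvPolynomial (Fin n × Fin n) R))
    (hA : ∀ i j, (A i j).totalDegree ≤ 1)
    (hf : ∀ d : (Fin n × Fin n) →₀ ℕ, l (coeff d A.det) = coeff d (perPoly (Fin n) ℂ)) :
    ∃ (G : ℕ) (α : Fin G → ℂ)
      (B : Fin G → Matrix (Fin (n ^ c + c)) (Fin (n ^ c + c)) (MvPolynomial (Fin n × Fin n) ℂ)),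
      G ≤ 2 ^ ((Nat.log 2 m + (2 * c + 4)) ^ (2 * c + 4)) ∧ (∀ q i j, (B q i j).totalDegree ≤ 1) ∧
        perPoly (Fin n) ℂ = ∑ q, C (α q) * (B q).det := by
  obtain ⟨G, α, B, hG, hB, hper⟩ := eq_sum_dets_of_nilradical_pow hν hR l A hA hf
  have hN : n ^ c + c ≤ m ^ c + c := Nat.add_le_add_right (Nat.pow_le_pow_left hnm c) c
  have hν1 : 1 ≤ (Nat.log 2 m + c) ^ c := by
    rcases Nat.eq_zero_or_pos c with hc | hc
    · rw [hc, pow_zero]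
    · exact Nat.one_le_pow _ _ (by omega)
  exact ⟨G, α, B, hG.trans ((mul_pow_pred_le_pow hν1).trans (depth_budget hN hs le_rfl)), hB, hper⟩

/-- **Uniform form (census reading of the crux).** Suppose `AbelianizationQP` holds with witness
algebras of polylogarithmic NILPOTENCY INDEX: there is `c` such that every affine determinantal
expression of `per_n` (`n ≥ 1`) of size `m` yields a representation of size `n^c + c` over a
commutative algebra `R` with `dim R ≤ 2^((log₂ m + c)^c)` and `(nilradical R)^((log₂ m + c)^c) = 0`.
Then subexponential determinantal expressions of the permanent ΣDet-REDUCE: with `c' = 2c + 4`,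
every determinantal expression of `per_n` of size `m` yields
`per_n = Σ_{q<G} α_q det B_q`, `G ≤ 2^((log₂ m + c')^c')`, `B_q` affine of size `n^c' + c'` over `ℂ`
(pad `B_q ⊕ 1`, `HasDetRepr.mono_holds`).  No such depth reduction is known for any polynomial
family; so the crux's witness algebra should be expected DEEP. [cite: HrubesYehudayoff2011, §2] -/
theorem sumDets_of_nilShallow_abelianization
    (h : ∃ c : ℕ, ∀ n m : ℕ, 1 ≤ n → HasDetRepr (perPoly (Fin n) ℂ) m →
      ∃ (R : Type) (_ : CommRing R) (_ : Algebra ℂ R) (_ : Module.Finite ℂ R),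
        (nilradical R) ^ ((Nat.log 2 m + c) ^ c) = ⊥ ∧
          Module.finrank ℂ R ≤ 2 ^ ((Nat.log 2 m + c) ^ c) ∧
            ∃ (l : R →ₗ[ℂ] ℂ)
              (A : Matrix (Fin (n ^ c + c)) (Fin (n ^ c + c)) (MvPolynomial (Fin n × Fin n) R)),
              (∀ i j, (A i j).totalDegree ≤ 1) ∧
                ∀ d : (Fin n × Fin n) →₀ ℕ, l (coeff d A.det) = coeff d (perPoly (Fin n) ℂ)) :
    ∃ c' : ℕ, ∀ n m : ℕ, 1 ≤ n → HasDetRepr (perPoly (Fin n) ℂ) m →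
      ∃ (G : ℕ) (α : Fin G → ℂ)
        (B : Fin G → Matrix (Fin (n ^ c' + c')) (Fin (n ^ c' + c')) (MvPolynomial (Fin n × Fin n) ℂ)),
        G ≤ 2 ^ ((Nat.log 2 m + c') ^ c') ∧ (∀ q i j, (B q i j).totalDegree ≤ 1) ∧
          perPoly (Fin n) ℂ = ∑ q, C (α q) * (B q).det := by
  obtain ⟨c, hc⟩ := h
  refine ⟨2 * c + 4, fun n m hn hdet => ?_⟩
  obtain ⟨R, _, _, _, hν, hR, l, A, hA, hf⟩ := hc n m hn hdet
  have hnm : n ≤ m := le_of_hasDetRepr_perPoly hdet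
  obtain ⟨G, α, B, hG, hB, hper⟩ := sum_dets_of_nilShallow_algRepr hnm le_rfl hν hR l A hA hf
  -- pad every `B_q` from size `n^c + c` to size `n^(2c+4) + (2c+4)`
  have hsize : n ^ c + c ≤ n ^ (2 * c + 4) + (2 * c + 4) :=
    Nat.add_le_add (Nat.pow_le_pow_right hn (by omega)) (by omega)
  have hpad : ∀ q, ∃ B' : Matrix (Fin (n ^ (2 * c + 4) + (2 * c + 4)))
      (Fin (n ^ (2 * c + 4) + (2 * c + 4))) (MvPolynomial (Fin n × Fin n) ℂ),
      (∀ i j, (B' i j).totalDegree ≤ 1) ∧ (B q).det = B'.det := fun q => by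
    obtain ⟨B', hB'1, hB'2⟩ := HasDetRepr.mono_holds (f := (B q).det) ⟨B q, hB q, rfl⟩ hsize
    exact ⟨B', hB'1, hB'2.symm⟩
  choose B' hB' hdet' using hpad
  refine ⟨G, α, B', hG, hB', ?_⟩
  rw [hper]
  exact Finset.sum_congr rfl fun q _ => by rw [hdet' q]

end Summit.ValiantsHypothesis.ValiantsHypothesis.Theorems.GrenetZeonAbelianizationQP

end
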